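import Literature.MathematicalPhysics.QuantumFieldTheory.BalabanImbrieJaffe1984to88.BIJ88DexpCondMean305
import Literature.MathematicalPhysics.QuantumFieldTheory.BalabanImbrieJaffe1984to88.BIJ88ExpectTilt305

/-!
# `BalabanImbrieJaffe1984to88.BIJ88DexpCondMeanMajorant305` — T. Bałaban, J. Imbrie, A. Jaffe, *Effective action and cluster properties of the
abelian Higgs model*, Commun. Math. Phys. **114** (1988) 257–315 [BalabanImbrieJaffe1988], Sect. 5.13 p. 305–307 [PDF 49–51] (with [Balaban1982Higgs2]
(2.28)–(2.29) p. 563): **THE EXPLICIT MAJORANT OF `⟨|D_n∘cm − D_n∘cm₀|⟩_s` THROUGH PRINT'S (2.29) BOUNDARY OPERATOR** — the place where the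
inter-cube DECAY enters the smoothness-free form of the p. 307 join mechanism (*"chains of covariances C_ω(α) … If the walk ω(α) wanders through
more than a few cubes, we begin to pickup factors e^{−cr(e_k)}"*).  On `Λ` the conditional-mean configuration is affine in the far fields,
`cm(φ)_x = d_x − (T φ↾Λᶜ)_x` with the drift `d = A_Λ⁻¹f↾Λ` and the boundary operator `T = A_Λ⁻¹A_{ΛΛᶜ}` ([Balaban1982Higgs2] (2.29):
`Σ_{b∈st(Λ)} C^{(0)}_Λ(x,b₋)A(b₋,b₊)φ(b₊)`, `C^{(0)}_Λ = A_Λ⁻¹`), `A = Δ_s`; hence, with `cm₀ = (d on Λ, 0 on Λᶜ)`, `a_{xy}` the coefficients of `D_n`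
(`BIJ88DexpCondMean305.Dfun_eq_sum_sum`), `R_x = Σ_k|T_{xk}|`, `M_k = (Δ_s⁻¹)_{kk} + (Δ_s⁻¹ℱ)_k²` (`BIJ88ExpectTilt305.expect_mul_apply_eq`):

  `⟨|D_n∘cm − D_n(cm₀)|⟩_s ≤ Σ_{x,y∈Λ} |a_{xy}| [ ½(R_x Σ_k|T_{xk}|M_k + R_y Σ_k|T_{yk}|M_k) + |d_x| Σ_k|T_{yk}|(1+M_k)/2 + |d_y| Σ_k|T_{xk}|(1+M_k)/2 ]`.

Every row `T_{x·}` is small when `C^{(0)}_Λ` decays between `□_n` (and the cubes it couples to) and `∂Λ` — letter (i) of the re-scoped flip item of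
row C2.Eq5.14.3-5.14.4 (r16 ROWS-C2-part2 v2.253) is consumed HERE and only here; combined with `BIJ88DexpCondMeanCov305.abs_dexp_singleton_le_condMean`
(`|∂{n}⟨H⟩(s)| ≤ 2K₀⟨|D_n∘cm − a|⟩_s`) and p36 g18's `BIJ88ActInLastCube309.abs_actIn_le_of_dexp_bound` it bounds the located activity of a polymer
whose observable does not see `□_n` and its neighbours.

statement-level skeleton of published theorems with citation tags; proofs where landed; nothing here is a claim about the Yang–Mills mass gap

PDF held: `paper:balaban1988-cmp114-bij-abelian-higgs-effective-action` (journal page = PDF page + 256); p. 307 (text layer p0051) as quoted;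
[Balaban1982Higgs2] p. 563 (2.29) quoted in `B2Eq228Conditioning`.

WHAT IS PROVED (unit `lit-balaban-p36`, generation 19 of the Phase-2 proof seat p36; SKELETON rows C2.Eq5.14.3-5.14.4 / C2.Eq5.13.3-5.13.4 of
`HOME/lit-balaban-r16/ROWS-C2-part2.md`, owner r16 — engine-level, letter-agnostic; 0 definitions, 0 `Prop` facts, theorems only).
* §1 `cm_apply_of_mem` (`cm_x = d_x − (Tφ↾Λᶜ)_x` on `Λ`), `cm₀_apply_of_mem`, `sum_sum_eq_subtype`, **`Dfun_cm_sub_eq`**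
  (`D_n∘cm − D_n(cm₀) = Σ_{x,y∈Λ} a_{xy}[t_xt_y − d_xt_y − d_yt_x]`, `t = Tφ↾Λᶜ`), `abs_mulVec_le`, `sq_mulVec_le` (weighted Cauchy–Schwarz),
  **`abs_Dfun_cm_sub_le`** (the pointwise majorant by `φ_k²`, `|φ_k|`, `k ∈ Λᶜ`).
* §2 **`expect_abs_Dfun_cm_sub_le`** — the display above (via `BIJ88ExpectTilt305.expect_eq_gaussProb` and the `gaussProb` moments of
  `BIJ88CondMoments305`).
HONEST SCOPE: an explicit inequality; which letters make its right side `≤ θ^{β′·(…)}` (decay of `A_Λ⁻¹`, sites per cube, coupling row sums, form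
bounds — `BIJ88ExpectTilt305.inv_apply_self_le`) is the instance files' business.  Imports `BIJ88DexpCondMean305`, `BIJ88ExpectTilt305` (p36 g19);
modifies nothing.  NOT summit progress; NOT continuum; NOT Clay.  Cell `lit-balaban` Phase 2, seat p36 gen 19 (owner r16, referee ref-5).
-/

noncomputable section

open MeasureTheory Matrix Finset Filter
open scoped BigOperators

namespace Literature.MathematicalPhysics.QuantumFieldTheory.BalabanImbrieJaffe1984to88.BIJ88DexpCondMeanMajorant305

open Literature.MathematicalPhysics.QuantumFieldTheory.Balaban1983to89
open B2Eq228Conditioning (In Out resIn resOut glue blkIn blkMix condShift weight source gaussProb isProbabilityMeasure_gaussProb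
  glue_apply_in)
open BIJ88DirichletForms305 (interpForm interpForm_posDef)
open BIJ88SecondOrder5133 (num Dfun)
open BIJ88CondMoments305 (integral_add_mul_add_apply_gaussProb integrable_apply_gaussProb integrable_mul_apply_gaussProb)
open BIJ88DexpCondMean305 (Dfun_eq_sum_sum coeff_eq_zero_of_not)
open BIJ88ExpectTilt305 (expect_eq_gaussProb)

variable {α I : Type} [Fintype α] [DecidableEq α] [Fintype I] [DecidableEq I] (blk : α → I) {Δ : Matrix α α ℝ}

/-! ## §1 The conditional mean on `Λ` is affine in the far fields; the pointwise majorant -/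

section Pointwise

variable (p : α → Prop) [DecidablePred p] (A : Matrix α α ℝ) (f : α → ℝ)

omit [Fintype I] [DecidableEq I] in
/-- **`cm(φ)_x = d_x − (Tφ↾Λᶜ)_x` for `x ∈ Λ`**, `d = A_Λ⁻¹f↾Λ`, `T = A_Λ⁻¹A_{ΛΛᶜ}` (print's (2.29) boundary form of the shift).
[cite: Balaban1982Higgs2, (2.29) p.563] -/
theorem cm_apply_of_mem (φ : α → ℝ) (i : In p) :
    glue p (condShift p A f (resOut p φ)) (resOut p φ) i
      = ((blkIn p A)⁻¹ *ᵥ resIn p f) i - (((blkIn p A)⁻¹ * blkMix p A) *ᵥ resOut p φ) i := by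
  rw [glue_apply_in, condShift, mulVec_sub, Pi.sub_apply, mulVec_mulVec]

omit [Fintype I] [DecidableEq I] in
/-- `cm₀_x = d_x` for `x ∈ Λ` (`cm₀ = (d on Λ, 0 on Λᶜ)`). [cite: Balaban1982Higgs2, (2.29) p.563] -/
theorem cm₀_apply_of_mem (i : In p) : glue p ((blkIn p A)⁻¹ *ᵥ resIn p f) 0 i = ((blkIn p A)⁻¹ *ᵥ resIn p f) i :=
  glue_apply_in p _ _ i

omit [DecidableEq α] [Fintype I] [DecidableEq I] in
/-- A double site sum supported on `Λ × Λ` is a double sum over `Λ`. [folklore] [cite: BalabanImbrieJaffe1988, §5.13 p.305] -/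
theorem sum_sum_eq_subtype (g : α → α → ℝ) (hg : ∀ x y, ¬ (p x ∧ p y) → g x y = 0) :
    ∑ x, ∑ y, g x y = ∑ i : In p, ∑ j : In p, g i j := by
  have hrow : ∀ x, ∑ y, g x y = ∑ j : In p, g x j := fun x => by
    rw [← Fintype.sum_subtype_add_sum_subtype p (fun y => g x y)]
    have h0 : ∑ j : {y // ¬ p y}, g x j = 0 := Finset.sum_eq_zero fun j _ => hg x j fun h => j.2 h.2
    rw [h0, add_zero]
  simp_rw [hrow]
  rw [← Fintype.sum_subtype_add_sum_subtype p (fun x => ∑ j : In p, g x j)]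
  have h0 : ∑ i : {x // ¬ p x}, ∑ j : In p, g i j = 0 :=
    Finset.sum_eq_zero fun i _ => Finset.sum_eq_zero fun j _ => hg i j fun h => i.2 h.1
  rw [h0, add_zero]

/-- **`D_n(cm(φ)) − D_n(cm₀) = Σ_{x,y∈Λ} a_{xy}[t_xt_y − d_xt_y − d_yt_x]`**, `t = Tφ↾Λᶜ` (the coefficients of `D_n` live on `Λ × Λ`).
[cite: BalabanImbrieJaffe1988, §5.13 p.305] -/
theorem Dfun_cm_sub_eq (s : I → ℝ) {n : I} (hpn : ∀ x, blk x = n → p x) (hfar : ∀ x y, blk x = n → ¬ p y → Δ x y = 0) (φ : α → ℝ) :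
    Dfun blk Δ s n (glue p (condShift p A f (resOut p φ)) (resOut p φ)) - Dfun blk Δ s n (glue p ((blkIn p A)⁻¹ *ᵥ resIn p f) 0)
      = ∑ i : In p, ∑ j : In p, (if blk i = n ∧ blk j ≠ n then s (blk j) * Δ i j else 0) *
          ((((blkIn p A)⁻¹ * blkMix p A) *ᵥ resOut p φ) i * (((blkIn p A)⁻¹ * blkMix p A) *ᵥ resOut p φ) j
            - ((blkIn p A)⁻¹ *ᵥ resIn p f) i * (((blkIn p A)⁻¹ * blkMix p A) *ᵥ resOut p φ) j
            - ((blkIn p A)⁻¹ *ᵥ resIn p f) j * (((blkIn p A)⁻¹ * blkMix p A) *ᵥ resOut p φ) i) := by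
  have hvan : ∀ (ψ : α → ℝ) (x y : α), ¬ (p x ∧ p y) →
      (if blk x = n ∧ blk y ≠ n then s (blk y) * Δ x y else 0) * (ψ x * ψ y) = 0 := fun ψ x y h => by
    rw [coeff_eq_zero_of_not blk Δ p s hpn hfar h, zero_mul]
  rw [Dfun_eq_sum_sum, Dfun_eq_sum_sum, sum_sum_eq_subtype p _ (hvan _), sum_sum_eq_subtype p _ (hvan _), ← Finset.sum_sub_distrib]
  refine Finset.sum_congr rfl fun i _ => ?_
  rw [← Finset.sum_sub_distrib]
  refine Finset.sum_congr rfl fun j _ => ?_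
  rw [cm_apply_of_mem p A f φ i, cm_apply_of_mem p A f φ j, cm₀_apply_of_mem p A f i, cm₀_apply_of_mem p A f j]
  ring

omit [DecidableEq α] [Fintype I] [DecidableEq I] in
/-- `|(My)_i| ≤ Σ_k |M_{ik}||y_k|`. [folklore] [cite: BalabanImbrieJaffe1988, §5.13 p.305] -/
theorem abs_mulVec_le (M : Matrix (In p) (Out p) ℝ) (y : Out p → ℝ) (i : In p) :
    |(M *ᵥ y) i| ≤ ∑ k, |M i k| * |y k| := by
  rw [mulVec, dotProduct]
  refine (Finset.abs_sum_le_sum_abs _ _).trans (le_of_eq (Finset.sum_congr rfl fun k _ => abs_mul _ _))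

omit [DecidableEq α] [Fintype I] [DecidableEq I] in
/-- Weighted Cauchy–Schwarz: `(My)_i² ≤ (Σ_k|M_{ik}|)·Σ_k|M_{ik}|y_k²`. [folklore] [cite: BalabanImbrieJaffe1988, §5.13 p.305] -/
theorem sq_mulVec_le (M : Matrix (In p) (Out p) ℝ) (y : Out p → ℝ) (i : In p) :
    (M *ᵥ y) i ^ 2 ≤ (∑ k, |M i k|) * ∑ k, |M i k| * y k ^ 2 := by
  have h1 := abs_mulVec_le p M y i
  have h2 : (∑ k, |M i k| * |y k|) ^ 2 ≤ (∑ k, Real.sqrt |M i k| ^ 2) * ∑ k, (Real.sqrt |M i k| * |y k|) ^ 2 := by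
    have h := Finset.sum_mul_sq_le_sq_mul_sq Finset.univ (fun k => Real.sqrt |M i k|) (fun k => Real.sqrt |M i k| * |y k|)
    refine le_trans (le_of_eq ?_) h
    congr 1
    refine Finset.sum_congr rfl fun k _ => ?_
    rw [← mul_assoc, ← sq, Real.sq_sqrt (abs_nonneg _)]
  have h3 : ∀ k, Real.sqrt |M i k| ^ 2 = |M i k| := fun k => Real.sq_sqrt (abs_nonneg _)
  have h4 : ∀ k, (Real.sqrt |M i k| * |y k|) ^ 2 = |M i k| * y k ^ 2 := fun k => by rw [mul_pow, h3, sq_abs]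
  simp only [h3, h4] at h2
  calc (M *ᵥ y) i ^ 2 = |(M *ᵥ y) i| ^ 2 := (sq_abs _).symm
    _ ≤ (∑ k, |M i k| * |y k|) ^ 2 := pow_le_pow_left₀ (abs_nonneg _) h1 2
    _ ≤ _ := h2

/-- **The pointwise majorant**: with `t = Tφ↾Λᶜ`, `R_x = Σ_k|T_{xk}|`,
`|D_n(cm(φ)) − D_n(cm₀)| ≤ Σ_{x,y∈Λ}|a_{xy}| [ ½(R_xΣ_k|T_{xk}|φ_k² + R_yΣ_k|T_{yk}|φ_k²) + |d_x|Σ_k|T_{yk}||φ_k| + |d_y|Σ_k|T_{xk}||φ_k| ]`.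
[cite: BalabanImbrieJaffe1988, §5.13 p.307] -/
theorem abs_Dfun_cm_sub_le (s : I → ℝ) {n : I} (hpn : ∀ x, blk x = n → p x) (hfar : ∀ x y, blk x = n → ¬ p y → Δ x y = 0) (φ : α → ℝ) :
    |Dfun blk Δ s n (glue p (condShift p A f (resOut p φ)) (resOut p φ)) - Dfun blk Δ s n (glue p ((blkIn p A)⁻¹ *ᵥ resIn p f) 0)|
      ≤ ∑ i : In p, ∑ j : In p, |(if blk i = n ∧ blk j ≠ n then s (blk j) * Δ i j else 0)| *
          ((1 / 2) * ((∑ k, |((blkIn p A)⁻¹ * blkMix p A) i k|) * ∑ k, |((blkIn p A)⁻¹ * blkMix p A) i k| * φ k ^ 2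
              + (∑ k, |((blkIn p A)⁻¹ * blkMix p A) j k|) * ∑ k, |((blkIn p A)⁻¹ * blkMix p A) j k| * φ k ^ 2)
            + |((blkIn p A)⁻¹ *ᵥ resIn p f) i| * ∑ k, |((blkIn p A)⁻¹ * blkMix p A) j k| * |φ k|
            + |((blkIn p A)⁻¹ *ᵥ resIn p f) j| * ∑ k, |((blkIn p A)⁻¹ * blkMix p A) i k| * |φ k|) := by
  set T : Matrix (In p) (Out p) ℝ := (blkIn p A)⁻¹ * blkMix p A with hT
  set d : In p → ℝ := (blkIn p A)⁻¹ *ᵥ resIn p f with hd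
  set y : Out p → ℝ := resOut p φ with hy
  have hyk : ∀ k : Out p, y k = φ k := fun k => rfl
  rw [Dfun_cm_sub_eq blk p A f s hpn hfar φ]
  refine (Finset.abs_sum_le_sum_abs _ _).trans (Finset.sum_le_sum fun i _ => ?_)
  refine (Finset.abs_sum_le_sum_abs _ _).trans (Finset.sum_le_sum fun j _ => ?_)
  rw [abs_mul]
  refine mul_le_mul_of_nonneg_left ?_ (abs_nonneg _)
  have hti := abs_mulVec_le p T y i
  have htj := abs_mulVec_le p T y j
  have hsi := sq_mulVec_le p T y i
  have hsj := sq_mulVec_le p T y j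
  simp only [hyk] at hti htj hsi hsj
  have h2 : |(T *ᵥ y) i| * |(T *ᵥ y) j| ≤ (1 / 2) * ((T *ᵥ y) i ^ 2 + (T *ᵥ y) j ^ 2) := by
    nlinarith [sq_nonneg (|(T *ᵥ y) i| - |(T *ᵥ y) j|), sq_abs ((T *ᵥ y) i), sq_abs ((T *ᵥ y) j)]
  calc |(T *ᵥ y) i * (T *ᵥ y) j - d i * (T *ᵥ y) j - d j * (T *ᵥ y) i|
      ≤ |(T *ᵥ y) i * (T *ᵥ y) j| + |d i * (T *ᵥ y) j| + |d j * (T *ᵥ y) i| := by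
        exact (abs_sub _ _).trans (add_le_add (abs_sub _ _) le_rfl)
    _ = |(T *ᵥ y) i| * |(T *ᵥ y) j| + |d i| * |(T *ᵥ y) j| + |d j| * |(T *ᵥ y) i| := by rw [abs_mul, abs_mul, abs_mul]
    _ ≤ (1 / 2) * ((∑ k, |T i k|) * ∑ k, |T i k| * φ k ^ 2 + (∑ k, |T j k|) * ∑ k, |T j k| * φ k ^ 2)
          + |d i| * ∑ k, |T j k| * |φ k| + |d j| * ∑ k, |T i k| * |φ k| := by
        have h3 : (1 / 2 : ℝ) * ((T *ᵥ y) i ^ 2 + (T *ᵥ y) j ^ 2)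
            ≤ (1 / 2) * ((∑ k, |T i k|) * ∑ k, |T i k| * φ k ^ 2 + (∑ k, |T j k|) * ∑ k, |T j k| * φ k ^ 2) :=
          mul_le_mul_of_nonneg_left (add_le_add hsi hsj) (by norm_num)
        exact add_le_add (add_le_add (h2.trans h3) (mul_le_mul_of_nonneg_left htj (abs_nonneg _)))
          (mul_le_mul_of_nonneg_left hti (abs_nonneg _))

end Pointwise

/-! ## §2 The majorant of `⟨|D_n∘cm − D_n(cm₀)|⟩_s` -/

section Expect

variable (hΔ : Δ.PosDef) (f : α → ℝ) {s : I → ℝ} (hs : ∀ l, 0 ≤ s l ∧ s l ≤ 1) (p : α → Prop) [DecidablePred p] {n : I}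
  (hpn : ∀ x, blk x = n → p x) (hfar : ∀ x y, blk x = n → ¬ p y → Δ x y = 0)

include hΔ hs hpn hfar in
/-- **THE MAJORANT**: with `A = Δ_s`, `T = A_Λ⁻¹A_{ΛΛᶜ}`, `d = A_Λ⁻¹ℱ↾Λ`, `m = A⁻¹ℱ`, `R_x = Σ_k|T_{xk}|`, `M_k = (A⁻¹)_{kk} + m_k²` (the four
abbreviations enter as parameters with their defining equations, to be instantiated by `rfl`),
`⟨|D_n∘cm − D_n(cm₀)|⟩_s ≤ Σ_{x,y∈Λ}|a_{xy}| [ ½(R_xΣ_k|T_{xk}|M_k + R_yΣ_k|T_{yk}|M_k) + |d_x|Σ_k|T_{yk}|(1+M_k)/2 + |d_y|Σ_k|T_{xk}|(1+M_k)/2 ]` —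
small exactly when the rows of the boundary operator from `□_n` and its coupled cubes into `Λᶜ` are small (decay of `C^{(0)}_Λ = A_Λ⁻¹`, p. 307
*"we begin to pickup factors e^{−cr(e_k)}"*). [cite: BalabanImbrieJaffe1988, §5.13 p.307] -/
theorem expect_abs_Dfun_cm_sub_le (A : Matrix α α ℝ) (hA : A = interpForm blk Δ s) (T : Matrix (In p) (Out p) ℝ)
    (hT : T = (blkIn p A)⁻¹ * blkMix p A) (d : In p → ℝ) (hd : d = (blkIn p A)⁻¹ *ᵥ resIn p f) (m : α → ℝ) (hm : m = A⁻¹ *ᵥ f) :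
    num blk Δ f (fun φ => |Dfun blk Δ s n (glue p (condShift p A f (resOut p φ)) (resOut p φ)) - Dfun blk Δ s n (glue p d 0)|) s
        / num blk Δ f (fun _ => 1) s
      ≤ ∑ i : In p, ∑ j : In p, |(if blk i = n ∧ blk j ≠ n then s (blk j) * Δ i j else 0)| *
          ((1 / 2) * ((∑ k, |T i k|) * ∑ k, |T i k| * (A⁻¹ k k + m k ^ 2) + (∑ k, |T j k|) * ∑ k, |T j k| * (A⁻¹ k k + m k ^ 2))
            + |d i| * ∑ k, |T j k| * ((1 + (A⁻¹ k k + m k ^ 2)) / 2)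
            + |d j| * ∑ k, |T i k| * ((1 + (A⁻¹ k k + m k ^ 2)) / 2)) := by
  have hAp : A.PosDef := by rw [hA]; exact interpForm_posDef blk hΔ hs
  haveI := isProbabilityMeasure_gaussProb hAp
  rw [expect_eq_gaussProb blk hΔ hs f, ← hA, ← hm]
  -- the second and first absolute moments of the shifted coordinates
  have hI2 : ∀ k : α, Integrable (fun z : α → ℝ => (z + m) k ^ 2) (gaussProb A) := fun k => by
    have h := (integrable_mul_apply_gaussProb hAp k k).add
      (((integrable_apply_gaussProb hAp k).const_mul (2 * m k)).add (integrable_const (m k * m k)))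
    refine h.congr (Eventually.of_forall fun z => ?_)
    simp only [Pi.add_apply]; ring
  have hE2 : ∀ k : α, ∫ z, (z + m) k ^ 2 ∂(gaussProb A) = A⁻¹ k k + m k ^ 2 := fun k => by
    have h := integral_add_mul_add_apply_gaussProb hAp m k k
    simp only [sq]
    exact h
  have hI1 : ∀ k : α, Integrable (fun z : α → ℝ => |(z + m) k|) (gaussProb A) := fun k =>
    ((integrable_apply_gaussProb hAp k).add (integrable_const (m k))).abs.congr (Eventually.of_forall fun z => by
      simp only [Pi.add_apply])
  have hE1 : ∀ k : α, ∫ z, |(z + m) k| ∂(gaussProb A) ≤ (1 + (A⁻¹ k k + m k ^ 2)) / 2 := fun k => by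
    have hpt : ∀ z : α → ℝ, |(z + m) k| ≤ (1 + (z + m) k ^ 2) / 2 := fun z => by
      nlinarith [sq_nonneg (|(z + m) k| - 1), sq_abs ((z + m) k), abs_nonneg ((z + m) k)]
    have hc1 : Integrable (fun _ : α → ℝ => (1 : ℝ)) (gaussProb A) := integrable_const 1
    have hInt' : Integrable (fun z : α → ℝ => 1 + (z + m) k ^ 2) (gaussProb A) :=
      (hc1.add (hI2 k)).congr (Eventually.of_forall fun z => rfl)
    have hInt : Integrable (fun z : α → ℝ => (1 + (z + m) k ^ 2) / 2) (gaussProb A) :=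
      (hInt'.div_const 2).congr (Eventually.of_forall fun z => rfl)
    have hval : ∫ z, (1 + (z + m) k ^ 2) / 2 ∂(gaussProb A) = (1 + (A⁻¹ k k + m k ^ 2)) / 2 := by
      rw [integral_div, integral_add hc1 (hI2 k), integral_const, hE2 k]
      simp
    rw [← hval]
    exact integral_mono_of_nonneg (Eventually.of_forall fun z => abs_nonneg _) hInt (Eventually.of_forall hpt)
  -- rows: integrability and integrals
  have hIrow2 : ∀ i : In p, Integrable (fun z : α → ℝ => ∑ k : Out p, |T i k| * (z + m) k ^ 2) (gaussProb A) := fun i =>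
    integrable_finsetSum _ fun k _ => (hI2 k).const_mul (|T i k|)
  have hIrow1 : ∀ i : In p, Integrable (fun z : α → ℝ => ∑ k : Out p, |T i k| * |(z + m) k|) (gaussProb A) := fun i =>
    integrable_finsetSum _ fun k _ => (hI1 k).const_mul (|T i k|)
  have hErow2 : ∀ i : In p, ∫ z, ∑ k : Out p, |T i k| * (z + m) k ^ 2 ∂(gaussProb A) = ∑ k : Out p, |T i k| * (A⁻¹ k k + m k ^ 2) := fun i => by
    rw [integral_finsetSum _ fun (k : Out p) _ => (hI2 k).const_mul (|T i k|)]
    exact Finset.sum_congr rfl fun k _ => by rw [integral_const_mul, hE2]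
  have hErow1 : ∀ i : In p, ∫ z, ∑ k : Out p, |T i k| * |(z + m) k| ∂(gaussProb A) ≤ ∑ k : Out p, |T i k| * ((1 + (A⁻¹ k k + m k ^ 2)) / 2) :=
    fun i => by
    rw [integral_finsetSum _ fun (k : Out p) _ => (hI1 k).const_mul (|T i k|)]
    exact Finset.sum_le_sum fun k _ => by rw [integral_const_mul]; exact mul_le_mul_of_nonneg_left (hE1 k) (abs_nonneg _)
  -- the four pieces of the (i,j) majorant
  have hF1 : ∀ i : In p, Integrable (fun z : α → ℝ => (∑ k : Out p, |T i k|) * ∑ k : Out p, |T i k| * (z + m) k ^ 2) (gaussProb A) := fun i =>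
    (hIrow2 i).const_mul (∑ k : Out p, |T i k|)
  have hF12 : ∀ i j : In p, Integrable (fun z : α → ℝ =>
      (∑ k : Out p, |T i k|) * ∑ k : Out p, |T i k| * (z + m) k ^ 2 + (∑ k : Out p, |T j k|) * ∑ k : Out p, |T j k| * (z + m) k ^ 2) (gaussProb A) := fun i j =>
    ((hF1 i).add (hF1 j)).congr (Eventually.of_forall fun z => rfl)
  have hF3 : ∀ i j : In p, Integrable (fun z : α → ℝ =>
      (1 / 2) * ((∑ k : Out p, |T i k|) * ∑ k : Out p, |T i k| * (z + m) k ^ 2 + (∑ k : Out p, |T j k|) * ∑ k : Out p, |T j k| * (z + m) k ^ 2)) (gaussProb A) :=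
    fun i j => (hF12 i j).const_mul (1 / 2)
  have hF4 : ∀ i j : In p, Integrable (fun z : α → ℝ => |d i| * ∑ k : Out p, |T j k| * |(z + m) k|) (gaussProb A) := fun i j =>
    (hIrow1 j).const_mul (|d i|)
  have hF34 : ∀ i j : In p, Integrable (fun z : α → ℝ =>
      (1 / 2) * ((∑ k : Out p, |T i k|) * ∑ k : Out p, |T i k| * (z + m) k ^ 2 + (∑ k : Out p, |T j k|) * ∑ k : Out p, |T j k| * (z + m) k ^ 2)
        + |d i| * ∑ k : Out p, |T j k| * |(z + m) k|) (gaussProb A) := fun i j =>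
    ((hF3 i j).add (hF4 i j)).congr (Eventually.of_forall fun z => rfl)
  have hterm : ∀ i j : In p, Integrable (fun z : α → ℝ => |(if blk i = n ∧ blk j ≠ n then s (blk j) * Δ i j else 0)| *
      ((1 / 2) * ((∑ k : Out p, |T i k|) * ∑ k : Out p, |T i k| * (z + m) k ^ 2 + (∑ k : Out p, |T j k|) * ∑ k : Out p, |T j k| * (z + m) k ^ 2)
        + |d i| * ∑ k : Out p, |T j k| * |(z + m) k| + |d j| * ∑ k : Out p, |T i k| * |(z + m) k|)) (gaussProb A) := fun i j =>
    (((hF34 i j).add (hF4 j i)).congr (Eventually.of_forall fun z => rfl)).const_mul _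
  have hrowsum : ∀ i : In p, Integrable (fun z : α → ℝ => ∑ j : In p, |(if blk i = n ∧ blk j ≠ n then s (blk j) * Δ i j else 0)| *
      ((1 / 2) * ((∑ k : Out p, |T i k|) * ∑ k : Out p, |T i k| * (z + m) k ^ 2 + (∑ k : Out p, |T j k|) * ∑ k : Out p, |T j k| * (z + m) k ^ 2)
        + |d i| * ∑ k : Out p, |T j k| * |(z + m) k| + |d j| * ∑ k : Out p, |T i k| * |(z + m) k|)) (gaussProb A) := fun i =>
    integrable_finsetSum _ fun j _ => hterm i j
  have hmaj : Integrable (fun z : α → ℝ => ∑ i : In p, ∑ j : In p, |(if blk i = n ∧ blk j ≠ n then s (blk j) * Δ i j else 0)| *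
      ((1 / 2) * ((∑ k : Out p, |T i k|) * ∑ k : Out p, |T i k| * (z + m) k ^ 2 + (∑ k : Out p, |T j k|) * ∑ k : Out p, |T j k| * (z + m) k ^ 2)
        + |d i| * ∑ k : Out p, |T j k| * |(z + m) k| + |d j| * ∑ k : Out p, |T i k| * |(z + m) k|)) (gaussProb A) :=
    integrable_finsetSum _ fun i _ => hrowsum i
  -- the (i,j) integrals
  have hEterm : ∀ i j : In p,
      ∫ z, ((1 / 2) * ((∑ k : Out p, |T i k|) * ∑ k : Out p, |T i k| * (z + m) k ^ 2 + (∑ k : Out p, |T j k|) * ∑ k : Out p, |T j k| * (z + m) k ^ 2)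
        + |d i| * ∑ k : Out p, |T j k| * |(z + m) k| + |d j| * ∑ k : Out p, |T i k| * |(z + m) k|) ∂(gaussProb A)
      ≤ (1 / 2) * ((∑ k : Out p, |T i k|) * ∑ k : Out p, |T i k| * (A⁻¹ k k + m k ^ 2) + (∑ k : Out p, |T j k|) * ∑ k : Out p, |T j k| * (A⁻¹ k k + m k ^ 2))
        + |d i| * ∑ k : Out p, |T j k| * ((1 + (A⁻¹ k k + m k ^ 2)) / 2)
        + |d j| * ∑ k : Out p, |T i k| * ((1 + (A⁻¹ k k + m k ^ 2)) / 2) := fun i j => by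
    rw [integral_add (hF34 i j) (hF4 j i), integral_add (hF3 i j) (hF4 i j), integral_const_mul, integral_add (hF1 i) (hF1 j),
      integral_const_mul, integral_const_mul, integral_const_mul, integral_const_mul, hErow2 i, hErow2 j]
    have hdi : 0 ≤ |d i| := abs_nonneg _
    have hdj : 0 ≤ |d j| := abs_nonneg _
    have h1 := mul_le_mul_of_nonneg_left (hErow1 j) hdi
    have h2 := mul_le_mul_of_nonneg_left (hErow1 i) hdj
    linarith
  -- assemble
  refine (integral_mono_of_nonneg (Eventually.of_forall fun z => abs_nonneg _) hmaj (Eventually.of_forall fun z => ?_)).trans ?_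
  · have h := abs_Dfun_cm_sub_le blk p A f s hpn hfar (z + m)
    rw [← hT, ← hd] at h
    exact h
  · rw [integral_finsetSum _ fun i _ => hrowsum i]
    refine Finset.sum_le_sum fun i _ => ?_
    rw [integral_finsetSum _ fun j _ => hterm i j]
    refine Finset.sum_le_sum fun j _ => ?_
    rw [integral_const_mul]
    exact mul_le_mul_of_nonneg_left (hEterm i j) (abs_nonneg _)

end Expect

end Literature.MathematicalPhysics.QuantumFieldTheory.BalabanImbrieJaffe1984to88.BIJ88DexpCondMeanMajorant305

end
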